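import Summits.BirchSwinnertonDyer.BirchSwinnertonDyer.Theorems.CyclotomicUntwistNineHondaCongruence
import Literature.NumberTheory.EllipticCurves.FormalGroupFiniteHeightProofs
import HarnessLib

/-!
# The logarithm of a good model over `𝓞_{ℚ₃(ζ₉)}` has UNBOUNDED denominators: `[ω_W] ≠ 0` in Katz's module,
# eigenvalues on the `ω`-line are unique, and no `ℚ₃`-rational eigenvalue exists (supersingular fibre)

Cell `pub/bsd-wall`, D-0145 line `route-BirchSwinnertonDyer-CyclotomicUntwist`, lead seat `bsd-line-cycu-p1` (gen 6),
lane «HONDA OVER `𝓞_{ℚ₃(ζ₉)}`» (part 4). Helper toward the print input `WeierstrassCurve.isDescendedFrobeniusMatrix_exists`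
of the K-SEP child C2 = stmt-BirchSwinnertonDyer-27549 (cruxes K1 `PSRankOneLowerHalfAtThree` = 21580 / K2 = 21581):
the NON-VANISHING input of every independence / descent argument on the `ω`-plane.

* `subst_ne_zero` — over a domain, `f ≠ 0`, `w ≠ 0`, `w(0) = 0 ⇒ f(w) ≠ 0`;
* `formalMul_three_map_ne_zero` — the reduction `[3]_Ē` of the multiplication-by-`3` series of a model `E/𝓞` with
  elliptic special fibre is non-zero in `𝔽₃⟦z⟧` (finite height; the tree's `formalMul_prime_map_toZMod_ne_zero` through a
  `ℤ₃`-lift of the special fibre);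
* `not_hbd_formalLog` — **for a model `E/𝓞` with elliptic special fibre, `log_𝓔` does NOT have bounded denominators**:
  if `3ᵈ·log_𝓔 = L ∈ 𝓞⟦z⟧` then `L([3]_E z) = 3·L(z)` gives `L̄([3]_Ē) = 0`, so `L̄ = 0`, `L = (1 − ζ₉)·L₁` with the same
  functional equation; iterating, `(1 − ζ₉)ᵏ ∣ [z]L = 3ᵈ` for all `k` — absurd (`3 = −(1 − ζ₉)⁶θ⁻¹`);
* `eq_zero_of_hbd_C_mul_classOmega` — hence `[ω_W] ≠ 0` in Katz's module: `HBD(x·classOmega) ⇒ x = 0`;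
  `eigenvalue_unique` — `φ[ω] ≡ λ[ω]` and `φ[ω] ≡ μ[ω] ⇒ λ = μ`;
* `not_hbd_expand_sub_algebraMap_mul_classOmega` — **with a SUPERSINGULAR special fibre (`3 ∣ a`) no `ℚ₃`-RATIONAL
  `μ` has `φ[ω] ≡ μ[ω]`**: Honda (`NineHonda.hbd_honda_classOmega`) would give `μ² − aμ + 3 = 0` in `ℚ₃`, excluded by
  `IsDescendedFrobeniusMatrix.no_padic_root_of_three_dvd`. (An eigenvalue in `ℚ₃(ζ₉) ⊋ ℚ₃(√−3)` is NOT excluded by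
  this — `X² − aX + 3` splits there; its exclusion is the Galois-descent step.)

THEOREMS ONLY (no `def`, no named fact, no `sorry`); BSD is not proved by this file and no crux is.

References: N. M. Katz, LNM 868 (1981) §5.3 (rank = height) [Katz1981CrystallineDieudonne]; J. H. Silverman, AEC (2009)
IV.7 (height of `Ê`), V.3 [SilvermanAEC2009]; T. Honda, J. Math. Soc. Japan 22 (1970) Thm. 9 [Honda1970].
-/

-- single-conjunct summit: `Summit.BirchSwinnertonDyer.BirchSwinnertonDyer.…` repeats the name by design
set_option linter.dupNamespace false
set_option autoImplicit false

noncomputable section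

open scoped Classical
open PowerSeries IsCyclotomicExtension Literature.NumberTheory.EllipticCurves.DescendedFrobenius
  Summit.BirchSwinnertonDyer.BirchSwinnertonDyer.Theorems.NineIntegers
  Summit.BirchSwinnertonDyer.BirchSwinnertonDyer.Theorems.NineHondaEstimate
  Summit.BirchSwinnertonDyer.BirchSwinnertonDyer.Theorems.DescendedFrobeniusTransfer
  Summit.BirchSwinnertonDyer.BirchSwinnertonDyer.Theorems.NineHonda

namespace Summit.BirchSwinnertonDyer.BirchSwinnertonDyer.Theorems.NineLogUnbounded

/-! ### §1 Substitution of a non-zero series is injective-like over a domain -/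

/-- Over a domain, substituting a non-zero `w` with `w(0) = 0` into a non-zero `f` gives a non-zero series
(`f = Xⁿ·f₁` with `f₁(0) ≠ 0`, so `f(w) = wⁿ·f₁(w)` with `f₁(w)(0) = f₁(0) ≠ 0`). [folklore] -/
theorem subst_ne_zero {R : Type*} [CommRing R] [IsDomain R] {f w : R⟦X⟧} (hf : f ≠ 0) (hw : w ≠ 0)
    (hw0 : constantCoeff w = 0) : f.subst w ≠ 0 := by
  have hws : HasSubst w := HasSubst.of_constantCoeff_zero' hw0
  obtain ⟨f₁, hf₁⟩ := X_pow_order_dvd (φ := f)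
  set n := f.order.toNat with hn
  have hf₁0 : constantCoeff f₁ ≠ 0 := by
    intro h0
    have hc : coeff n f = 0 := by
      rw [hf₁, coeff_X_pow_mul', if_pos le_rfl, Nat.sub_self, coeff_zero_eq_constantCoeff_apply, h0]
    have hne : coeff n f ≠ 0 := by
      rw [hn]
      exact coeff_order hf
    exact hne hc
  rw [hf₁, subst_mul hws, subst_pow hws, subst_X hws]
  refine mul_ne_zero (pow_ne_zero _ hw) fun h0 => hf₁0 ?_
  rw [← WeierstrassCurve.constantCoeff_subst_eq_constantCoeff (f := f₁) hw0, h0, map_zero]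

/-! ### §2 `[3]_Ē ≠ 0` for the special fibre of a model over `𝓞` -/

/-- **Finite height of the special fibre**: for `E/𝓞` with elliptic special fibre `Ē = E ⊗_ρ 𝔽₃`, the reduction of
`[3]_E` is non-zero in `𝔽₃⟦z⟧` (tree `formalMul_prime_map_toZMod_ne_zero` applied to a `ℤ₃`-lift of `Ē`).
[cite: SilvermanAEC2009, IV.7 and V.3] -/
theorem formalMul_three_map_ne_zero (E : WeierstrassCurve ONine) (ρ : ONine →+* ZMod 3) [(E.map ρ).IsElliptic] :
    (E.formalMul 3).map ρ ≠ 0 := by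
  set Ē := E.map ρ with hĒ
  obtain ⟨V, hV⟩ : ∃ V : WeierstrassCurve ℤ_[3], V.map PadicInt.toZMod = Ē :=
    ⟨⟨(Ē.a₁.val : ℤ_[3]), (Ē.a₂.val : ℤ_[3]), (Ē.a₃.val : ℤ_[3]), (Ē.a₄.val : ℤ_[3]), (Ē.a₆.val : ℤ_[3])⟩, by
      ext <;> simp [WeierstrassCurve.map]⟩
  haveI hEt : (V.map PadicInt.toZMod).IsElliptic := by rw [hV]; infer_instance
  haveI hE : (V.map PadicInt.Coe.ringHom).IsElliptic := by
    refine ⟨?_⟩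
    rw [WeierstrassCurve.map_Δ, isUnit_iff_ne_zero]
    intro h0
    have h0' : ((V.Δ : ℤ_[3]) : ℚ_[3]) = 0 := h0
    have hΔ0 : V.Δ = 0 := PadicInt.coe_eq_zero.mp h0'
    have hu : IsUnit (V.map PadicInt.toZMod).Δ := hEt.isUnit
    rw [WeierstrassCurve.map_Δ, hΔ0, map_zero] at hu
    exact not_isUnit_zero hu
  have h := V.formalMul_prime_map_toZMod_ne_zero (by norm_num : (3 : ℕ) ≠ 2)
  rw [hV] at h
  rwa [WeierstrassCurve.map_formalMul]

/-! ### §3 `log_𝓔` has unbounded denominators -/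

/-- `1 − ζ₉ ≠ 0` in `𝓞` (`ζ₉ ≠ 1`). [folklore] -/
theorem varpi_ne_zero : (⟨1 - zeta 9 ℚ_[3] KNine, one_sub_zeta_mem⟩ : ONine) ≠ 0 := by
  intro h0
  have h1 : (1 : KNine) - zeta 9 ℚ_[3] KNine = 0 := congrArg Subtype.val h0
  exact zeta_spec.ne_one (by norm_num) (sub_eq_zero.mp h1).symm

/-- One descent step: an `𝓞`-series `L` with `L([3]_E z) = 3·L(z)` is divisible by `1 − ζ₉` (reduce mod `ρ`:
`L̄([3]_Ē) = 0` with `[3]_Ē ≠ 0`, so `L̄ = 0`). [cite: Katz1981CrystallineDieudonne, §5.3] -/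
theorem exists_eq_C_varpi_mul_of_functional_eq (E : WeierstrassCurve ONine) (ρ : ONine →+* ZMod 3)
    [(E.map ρ).IsElliptic] {L : ONine⟦X⟧} (hL : L.subst (E.formalMul 3) = 3 * L) :
    ∃ L₁ : ONine⟦X⟧, L = PowerSeries.C (⟨1 - zeta 9 ℚ_[3] KNine, one_sub_zeta_mem⟩ : ONine) * L₁ ∧
      L₁.subst (E.formalMul 3) = 3 * L₁ := by
  set ϖ : ONine := ⟨1 - zeta 9 ℚ_[3] KNine, one_sub_zeta_mem⟩ with hϖ
  -- reduce the functional equation mod `ρ`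
  have hred : (L.map ρ).subst ((E.formalMul 3).map ρ) = 0 := by
    have h := congrArg (PowerSeries.map ρ) hL
    rw [WeierstrassCurve.powerSeries_map_subst ρ (E.hasSubst_formalMul 3), map_mul,
      show (PowerSeries.map ρ) (3 : ONine⟦X⟧) = 0 by
        rw [show (3 : ONine⟦X⟧) = PowerSeries.C (3 : ONine) from (map_ofNat _ 3).symm, map_C, map_ofNat,
          show (3 : ZMod 3) = 0 from rfl, map_zero], zero_mul] at h
    exact h
  have hL0 : L.map ρ = 0 := by
    by_contra hne
    exact subst_ne_zero hne (formalMul_three_map_ne_zero E ρ)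
      (by rw [← coeff_zero_eq_constantCoeff, coeff_map, coeff_zero_eq_constantCoeff, E.constantCoeff_formalMul,
        map_zero]) hred
  obtain ⟨L₁, hL₁⟩ := exists_eq_C_varpi_mul_of_map_eq_zero ρ hL0
  refine ⟨L₁, hL₁, ?_⟩
  have hϖ0 : (PowerSeries.C ϖ : ONine⟦X⟧) ≠ 0 := by
    intro h0
    have hϖz : ϖ = 0 := by
      have := congrArg constantCoeff h0
      rwa [constantCoeff_C, map_zero] at this
    exact varpi_ne_zero hϖz
  have hs : HasSubst (E.formalMul 3) := E.hasSubst_formalMul 3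
  have e : (PowerSeries.C ϖ * L₁).subst (E.formalMul 3) = PowerSeries.C ϖ * L₁.subst (E.formalMul 3) := by
    rw [← coe_substAlgHom hs, map_mul, C_eq_algebraMap, AlgHom.commutes]
  have h := hL
  rw [hL₁, e, mul_left_comm] at h
  exact mul_left_cancel₀ hϖ0 h

/-- `1 − ζ₉ ≠ 0` in `𝓞` and it is not a unit (it lies in the kernel of every reduction map). [folklore] -/
theorem varpi_not_isUnit : ¬ IsUnit (⟨1 - zeta 9 ℚ_[3] KNine, one_sub_zeta_mem⟩ : ONine) := by
  obtain ⟨ρ⟩ := nonempty_residueMap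
  intro hu
  have h := hu.map ρ
  rw [residueMap_one_sub_zeta ρ] at h
  exact not_isUnit_zero h

/-- **`log_𝓔` has unbounded denominators** for a model `E/𝓞` whose special fibre `E ⊗_ρ 𝔽₃` is elliptic: there is
no `d` with `3ᵈ·[zⁿ]log_𝓔 ∈ 𝓞` for all `n`. [cite: Katz1981CrystallineDieudonne, Thm. 5.3.3] [cite: SilvermanAEC2009, IV.7] -/
theorem not_hbd_formalLog (E : WeierstrassCurve ONine) (ρ : ONine →+* ZMod 3) [(E.map ρ).IsElliptic] :
    ¬ HasBoundedDenominators (E.map (algebraMap ONine KNine)).formalLog := by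
  set ι := algebraMap ONine KNine with hι
  set 𝓔 := E.map ι with h𝓔
  set ϖ : ONine := ⟨1 - zeta 9 ℚ_[3] KNine, one_sub_zeta_mem⟩ with hϖ
  rintro ⟨d, hd⟩
  -- lift `3ᵈ log` to `𝓞⟦X⟧`
  set L : ONine⟦X⟧ := PowerSeries.mk fun n => (⟨(3 : KNine) ^ d * coeff n 𝓔.formalLog, hd n⟩ : ONine) with hLdef
  have hL : L.map ι = PowerSeries.C ((3 : KNine) ^ d) * 𝓔.formalLog := by
    ext n
    rw [coeff_map, hLdef, coeff_mk, coeff_C_mul]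
    rfl
  -- the functional equation `L([3]) = 3 L` in `𝓞⟦X⟧`
  have hinj : Function.Injective (PowerSeries.map ι) := PowerSeries.map_injective ι Subtype.val_injective
  have hFE : L.subst (E.formalMul 3) = 3 * L := by
    apply hinj
    have hs : HasSubst (𝓔.formalMul 3) := 𝓔.hasSubst_formalMul 3
    have hmap3 : (PowerSeries.map ι) (3 : ONine⟦X⟧) = 3 := by
      rw [show (3 : ONine⟦X⟧) = PowerSeries.C (3 : ONine) from (map_ofNat _ 3).symm, map_C, map_ofNat, map_ofNat]
    rw [WeierstrassCurve.powerSeries_map_subst ι (E.hasSubst_formalMul 3), WeierstrassCurve.map_formalMul, ← h𝓔,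
      map_mul (PowerSeries.map ι) 3 L, hmap3, hL, ← coe_substAlgHom hs, map_mul, C_eq_algebraMap, AlgHom.commutes,
      coe_substAlgHom, 𝓔.formalLog_subst_formalMul_rat 3, nsmul_eq_mul]
    push_cast
    ring
  -- iterate: `ϖᵏ ∣ L` for every `k`
  have hiter : ∀ k : ℕ, ∃ Lk : ONine⟦X⟧, L = PowerSeries.C ϖ ^ k * Lk ∧ Lk.subst (E.formalMul 3) = 3 * Lk := by
    intro k
    induction k with
    | zero => exact ⟨L, by rw [pow_zero, one_mul], hFE⟩
    | succ k ih =>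
      obtain ⟨Lk, hLk, hFk⟩ := ih
      obtain ⟨L₁, hL₁, hF₁⟩ := exists_eq_C_varpi_mul_of_functional_eq E ρ hFk
      exact ⟨L₁, by rw [hLk, hL₁, pow_succ, mul_assoc], hF₁⟩
  -- read the coefficient of `z`: `ϖ^(6d+1) ∣ 3ᵈ` in `𝓞`
  obtain ⟨Lk, hLk, -⟩ := hiter (6 * d + 1)
  have hc1 : coeff 1 L = (3 : ONine) ^ d := by
    have h1 : coeff 1 L = (⟨(3 : KNine) ^ d * coeff 1 𝓔.formalLog, hd 1⟩ : ONine) := by rw [hLdef, coeff_mk]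
    rw [h1]
    apply Subtype.ext
    push_cast
    simp [WeierstrassCurve.coeff_one_formalLog]
  have hdvd : ϖ ^ (6 * d + 1) ∣ (3 : ONine) ^ d := by
    refine ⟨coeff 1 Lk, ?_⟩
    rw [← hc1, hLk, ← map_pow, coeff_C_mul]
  -- `3ᵈ = ϖ^(6d) · unit`
  have h3 : (3 : ONine) = ϖ ^ 6 * (-⟨_, thetaInv_mem⟩) := by
    apply Subtype.ext
    push_cast
    rw [three_eq_neg_pow_six_mul_thetaInv zeta_spec]
    ring
  have hunit : IsUnit (-(⟨_, thetaInv_mem⟩ : ONine)) := by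
    refine (IsUnit.neg ?_)
    refine IsUnit.of_mul_eq_one ⟨_, theta_mem⟩ (Subtype.ext ?_)
    push_cast
    rw [mul_comm]
    exact theta_mul_thetaInv zeta_spec
  rw [h3, mul_pow, ← pow_mul, pow_succ] at hdvd
  -- cancel `ϖ^(6d)`: `ϖ ∣ unit`
  have hϖ0 : ϖ ^ (6 * d) ≠ 0 := pow_ne_zero _ varpi_ne_zero
  obtain ⟨c, hc⟩ := hdvd
  have hc' : ϖ ^ (6 * d) * (-⟨_, thetaInv_mem⟩) ^ d = ϖ ^ (6 * d) * (ϖ * c) := by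
    rw [hc]; ring
  have hcancel := mul_left_cancel₀ hϖ0 hc'
  have hϖunit : IsUnit ϖ := isUnit_of_mul_isUnit_left (hcancel ▸ hunit.pow d)
  exact varpi_not_isUnit hϖunit

/-- **`[ω_W] ≠ 0` in Katz's module**: for a good model `𝓜` of `W` (elliptic special fibre), `x·classOmega 𝓜` has
bounded denominators only for `x = 0` (`classOmega = u⁻¹·log_𝓔`). [cite: Katz1981CrystallineDieudonne, Thm. 5.3.3] -/
theorem eq_zero_of_hbd_C_mul_classOmega {W : WeierstrassCurve ℚ} (𝓜 : W.NineGoodModel) (ρ : ONine →+* ZMod 3)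
    {x : KNine} (hx : HasBoundedDenominators (PowerSeries.C x * 𝓜.classOmega)) : x = 0 := by
  by_contra hx0
  haveI := isElliptic_specialFibre 𝓜 ρ
  apply not_hbd_formalLog 𝓜.E ρ
  have hu : ((𝓜.C.u⁻¹ : KNineˣ) : KNine) ≠ 0 := Units.ne_zero _
  have h := hbd_C_mul (x * ((𝓜.C.u⁻¹ : KNineˣ) : KNine))⁻¹ hx
  have e : PowerSeries.C (x * ((𝓜.C.u⁻¹ : KNineˣ) : KNine))⁻¹ * (PowerSeries.C x * 𝓜.classOmega) =
      𝓜.curve.formalLog := by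
    rw [WeierstrassCurve.NineGoodModel.classOmega, smul_eq_C_mul, ← mul_assoc, ← mul_assoc, ← map_mul, ← map_mul,
      show (x * ((𝓜.C.u⁻¹ : KNineˣ) : KNine))⁻¹ * x * ((𝓜.C.u⁻¹ : KNineˣ) : KNine) = 1 by
        rw [mul_assoc, inv_mul_cancel₀ (mul_ne_zero hx0 hu)], map_one, one_mul]
  rw [e] at h
  exact h

/-- **Eigenvalues on the `ω`-line are unique**: `φ[ω] ≡ λ[ω]` and `φ[ω] ≡ μ[ω]` modulo bounded denominators force
`λ = μ`. [cite: Katz1981CrystallineDieudonne, Thm. 5.3.3] -/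
theorem eigenvalue_unique {W : WeierstrassCurve ℚ} (𝓜 : W.NineGoodModel) (ρ : ONine →+* ZMod 3) {lam mu : KNine}
    (h1 : HasBoundedDenominators (expand 3 (by norm_num) 𝓜.classOmega - PowerSeries.C lam * 𝓜.classOmega))
    (h2 : HasBoundedDenominators (expand 3 (by norm_num) 𝓜.classOmega - PowerSeries.C mu * 𝓜.classOmega)) :
    lam = mu := by
  have h := h2.sub h1
  have e : expand 3 (by norm_num) 𝓜.classOmega - PowerSeries.C mu * 𝓜.classOmega -
      (expand 3 (by norm_num) 𝓜.classOmega - PowerSeries.C lam * 𝓜.classOmega) =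
      PowerSeries.C (lam - mu) * 𝓜.classOmega := by
    rw [map_sub]; ring
  rw [e] at h
  exact (sub_eq_zero.mp (eq_zero_of_hbd_C_mul_classOmega 𝓜 ρ h)).symm |>.symm

/-- **No `ℚ₃`-rational eigenvalue on the `ω`-line when the special fibre is supersingular**: if `3 ∣ a` then
`φ[ω] ≡ μ[ω]` with `μ ∈ ℚ₃` is impossible — Honda's `φ²[ω] ≡ aφ[ω] − 3[ω]` would give `μ² − aμ + 3 = 0` in `ℚ₃`
(`no_padic_root_of_three_dvd`). The eigenvalues live in `ℚ₃(√−3) ⊂ ℚ₃(ζ₉)`, NOT in `ℚ₃`: this is the input of the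
Galois descent of the `ω`-plane. [cite: Katz1981CrystallineDieudonne, (6.1.1)] [cite: Honda1970, Thm. 9] -/
theorem not_hbd_expand_sub_algebraMap_mul_classOmega {W : WeierstrassCurve ℚ} (𝓜 : W.NineGoodModel)
    (ρ : ONine →+* ZMod 3) (hss : (3 : ℤ) ∣ 𝓜.specialFibreTrace ρ) (μ : ℚ_[3]) :
    ¬ HasBoundedDenominators (expand 3 (by norm_num) 𝓜.classOmega -
      PowerSeries.C (algebraMap ℚ_[3] KNine μ) * 𝓜.classOmega) := by
  intro h
  set ι := algebraMap ℚ_[3] KNine with hι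
  set Ω := 𝓜.classOmega with hΩ
  set a : ℤ := 𝓜.specialFibreTrace ρ with ha
  -- Honda: `φ²Ω − a φΩ + 3Ω ∈ HBD`
  have R₂ := hbd_honda_classOmega 𝓜 ρ
  rw [← ha, ← hΩ, (expand_expand (a := 3) (b := 3) (c := 3 ^ 2) (by norm_num) (by norm_num)
    (Literature.RingTheory.FormalGroups.prime_sq_ne_zero 3) (by norm_num) Ω).symm] at R₂
  -- `φ(h)`, and combine: `(μ² − aμ + 3)Ω ∈ HBD`
  have hφ := hbd_expand 3 (by norm_num) h
  rw [map_sub, map_mul, expand_C] at hφ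
  have hsum := (R₂.sub hφ).sub (hbd_C_mul (ι μ - (a : KNine)) h)
  have e : expand 3 (by norm_num) (expand 3 (by norm_num) Ω) - PowerSeries.C (a : KNine) * expand 3 (by norm_num) Ω +
        3 * Ω - (expand 3 (by norm_num) (expand 3 (by norm_num) Ω) - PowerSeries.C (ι μ) * expand 3 (by norm_num) Ω) -
        PowerSeries.C (ι μ - (a : KNine)) * (expand 3 (by norm_num) Ω - PowerSeries.C (ι μ) * Ω) =
      PowerSeries.C (ι (3 - μ * ((a : ℚ_[3]) - μ))) * Ω := by
    simp only [map_sub, map_mul, map_ofNat, map_intCast]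
    ring
  rw [e] at hsum
  have h0 := eq_zero_of_hbd_C_mul_classOmega 𝓜 ρ hsum
  rw [map_eq_zero_iff ι ι.injective, sub_eq_zero] at h0
  exact WeierstrassCurve.IsDescendedFrobeniusMatrix.no_padic_root_of_three_dvd hss μ h0.symm

end Summit.BirchSwinnertonDyer.BirchSwinnertonDyer.Theorems.NineLogUnbounded

end
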